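import Mathlib
import HarnessLib
import Summits.QuantumFields.YangMills.Theorems.MirrorModularBoostsHypercubicLimitCouplingResponseDefsC
import Summits.QuantumFields.YangMills.Theorems.PencilRigidityWeakCouplingHypercubicLimitStubCountertermBound
import Summits.QuantumFields.YangMills.Theorems.LangevinControlUVFemtoCurvatureTwoPointPlaquetteCovCeiling
import Literature.MathematicalPhysics.QuantumFieldTheory.WilsonAxisSymmetry
import Literature.MathematicalPhysics.QuantumLattice.LatticeGaugeDLRCovarianceSplit

/-!
# Crux `SelfNormalisedMomentBoundsR` (stmt-QuantumFields-18014) — line `Sketch`, stub `stub_planeMean`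

Helper file of the lead skeleton `work/SelfNormalisedMomentBoundsR.lean` (route `ScalingWindowSplit`, crux
U_R = `SelfNormalisedMomentBoundsR`), line `Sketch`, registered stub `stub_planeMean` (the `n = 1` case of the
line): **for a scheme whose curvature counterterm at step `k` is the torus mean of the Wilson action density,
every plane field has vanishing one-point function.**

Route.
1. `integral_planeField_eq`: `∫ Φ^{q}_k(f) dμ_k = c_k a_k⁴ Σₓ f(a_k x) ∫ (O_q(τ₋ₓ Ũ) − m_k/6) dμ_k`, so it suffices
   that every centred plaquette mean vanishes.
2. Translation invariance of Wilson's torus state read on the periodic lift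
   (tree `QuantumLattice.integral_comp_configShift_torusLift`): `∫ O_q(τ₋ₓ Ũ) dμ_k = ∫ O_q(Ũ) dμ_k`.
3. Axis symmetry of Wilson's torus state (`integral_comp_configPerm_wilsonMeasure`, `configPermZd_torusLift`,
   `plaquetteObs_configPermZd`): the torus mean `e_{ij} = ∫ Re tr ρ(Ũ_{0,ij}) dμ_k` is the same number for all
   ordered pairs `i ≠ j` (a permutation of the four axes takes `(0, 1)` to `(i, j)`,
   `FemtoCurvatureTwoPoint.exists_perm_apply_zero_one`).
4. The action density is `Σ_{i<j} Re tr ρ(U_{0,ij})` (six planes, `QuantumLattice.sum_pairs_fin_four`), so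
   `m_k = 6 e_{01}` and every centred mean is `e_{01} − 6 e_{01} / 6 = 0`.
[folklore]
-/

noncomputable section

open scoped SchwartzMap BigOperators Topology
open MeasureTheory Filter Topology
open Literature.MathematicalPhysics.AQFT Literature.MathematicalPhysics.QuantumLattice
open Literature.MathematicalPhysics.QuantumFieldTheory Literature.Probability.LatticeModels
open Summit.QuantumFields.YangMills.Cruxes.HypercubicLimit.CouplingResponse
open Summit.QuantumFields.YangMills.Theorems.StrongCouplingIRTrivial.TwoPoint (integrable_shift_lift)
open Summit.QuantumFields.YangMills.Theorems.WeakCouplingHypercubicLimit.TraceNormColdPressure (integral_planeField_eq)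
open Summit.QuantumFields.YangMills.Theorems.FemtoCurvatureTwoPoint (exists_perm_apply_zero_one)

namespace Summit.QuantumFields.YangMills.Theorems.ScalingWindowSplit.SelfNormalisedMomentBoundsR

/-! ## Helpers: axis symmetry of the plaquette means, the six planes -/

section Torus

variable {G : Type} [Group G] [TopologicalSpace G] [IsTopologicalGroup G] [CompactSpace G]
  [MeasurableSpace G] [BorelSpace G]

/-- **A species read on the periodic lift is integrable** for Wilson's torus state (bounded, measurable,
probability measure). [folklore] -/
theorem integrable_species_torusLift (r : LatticeRep G) (β : ℝ) (S : ℕ) [NeZero S] (O : YMSpecies G) :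
    Integrable (fun U : GaugeConfig 4 S G => O.F (torusLift S U)) (wilsonMeasure r.ρ β) := by
  haveI : IsProbabilityMeasure (wilsonMeasure r.ρ β : Measure (GaugeConfig 4 S G)) :=
    isProbabilityMeasure_wilsonMeasure (d := 4) (L := S) r.ρ r.continuous β
  obtain ⟨C, hC⟩ := O.bounded
  refine Integrable.of_bound (O.measurable.comp (measurable_torusLift S)).aestronglyMeasurable C
    (ae_of_all _ fun U => ?_)
  rw [Real.norm_eq_abs]
  exact hC _

/-- **Axis symmetry of the torus plaquette means**: relabelling the two directions of the plaquette at the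
origin by a permutation `π` of the axes does not change its torus mean, `∫ O_{π i, π j}(Ũ) dμ = ∫ O_{ij}(Ũ) dμ`
(change of variables `U ↦ P_π U`, `configPermZd_torusLift`, `plaquetteObs_configPermZd`). [folklore] -/
theorem integral_plaquetteObs_torusLift_perm (r : LatticeRep G) (β : ℝ) (S : ℕ) [NeZero S]
    (π : Equiv.Perm (Fin 4)) (i j : Fin 4) :
    ∫ U, plaquetteObs r.ρ 0 (π i) (π j) (torusLift S U) ∂(wilsonMeasure r.ρ β : Measure (GaugeConfig 4 S G)) =
      ∫ U, plaquetteObs r.ρ 0 i j (torusLift S U) ∂(wilsonMeasure r.ρ β : Measure (GaugeConfig 4 S G)) := by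
  rw [← integral_comp_configPerm_wilsonMeasure r.ρ r.continuous β π
    (fun U : GaugeConfig 4 S G => plaquetteObs r.ρ 0 (π i) (π j) (torusLift S U))]
  refine integral_congr_ae (ae_of_all _ fun U => ?_)
  show plaquetteObs r.ρ 0 (π i) (π j) (torusLift S (configPerm π U)) = _
  rw [← configPermZd_torusLift, plaquetteObs_configPermZd, sitePermZd_zero, Equiv.symm_apply_apply,
    Equiv.symm_apply_apply]

/-- **All twelve ordered plaquette orientations have the same torus mean**, `∫ O_{ij}(Ũ) dμ = ∫ O_{01}(Ũ) dμ` for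
`i ≠ j`. [folklore] -/
theorem integral_plaquetteObs_torusLift_eq (r : LatticeRep G) (β : ℝ) (S : ℕ) [NeZero S] {i j : Fin 4}
    (hij : i ≠ j) :
    ∫ U, plaquetteObs r.ρ 0 i j (torusLift S U) ∂(wilsonMeasure r.ρ β : Measure (GaugeConfig 4 S G)) =
      ∫ U, plaquetteObs r.ρ 0 0 1 (torusLift S U) ∂(wilsonMeasure r.ρ β : Measure (GaugeConfig 4 S G)) := by
  obtain ⟨π, h0, h1⟩ := exists_perm_apply_zero_one hij
  rw [← integral_plaquetteObs_torusLift_perm r β S π 0 1, h0, h1]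

/-- **The torus mean of the action density is six times a plaquette mean**:
`∫ Σ_{i<j} O_{ij}(Ũ) dμ = 6 ∫ O_{01}(Ũ) dμ`. [folklore] -/
theorem integral_curvature_F_torusLift (r : LatticeRep G) (β : ℝ) (S : ℕ) [NeZero S] :
    ∫ U, r.curvature.F (torusLift S U) ∂(wilsonMeasure r.ρ β : Measure (GaugeConfig 4 S G)) =
      6 * ∫ U, plaquetteObs r.ρ 0 0 1 (torusLift S U) ∂(wilsonMeasure r.ρ β : Measure (GaugeConfig 4 S G)) := by
  haveI : IsProbabilityMeasure (wilsonMeasure r.ρ β : Measure (GaugeConfig 4 S G)) :=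
    isProbabilityMeasure_wilsonMeasure (d := 4) (L := S) r.ρ r.continuous β
  -- integrability of the plane terms (only `i < j` is a species)
  have hI : ∀ i j : Fin 4, Integrable (fun U : GaugeConfig 4 S G =>
      if i < j then plaquetteObs r.ρ 0 i j (torusLift S U) else 0) (wilsonMeasure r.ρ β) := by
    intro i j
    by_cases h : i < j
    · simp only [h, ↓reduceIte]
      exact integrable_species_torusLift r β S (planeSpecies r ⟨(i, j), h⟩)
    · simp only [h, ↓reduceIte]
      exact integrable_const _
  have hint : ∀ i j : Fin 4,
      ∫ U, (if i < j then plaquetteObs r.ρ 0 i j (torusLift S U) else 0)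
          ∂(wilsonMeasure r.ρ β : Measure (GaugeConfig 4 S G)) =
        if i < j then ∫ U, plaquetteObs r.ρ 0 0 1 (torusLift S U)
          ∂(wilsonMeasure r.ρ β : Measure (GaugeConfig 4 S G)) else 0 := by
    intro i j
    by_cases h : i < j
    · simp only [h, ↓reduceIte]
      exact integral_plaquetteObs_torusLift_eq r β S h.ne
    · simp only [h, ↓reduceIte, integral_zero]
  show ∫ U, actionDensity r.ρ (torusLift S U) ∂(wilsonMeasure r.ρ β : Measure (GaugeConfig 4 S G)) = _
  unfold actionDensity
  rw [integral_finsetSum _ fun i _ => integrable_finsetSum _ fun j _ => hI i j]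
  simp_rw [integral_finsetSum _ fun j _ => hI _ j, hint]
  exact sum_pairs_fin_four _

/-- **The centred plaquette means of a torus-mean-centred scheme vanish**: if `m = ∫ Σ_{i<j} O_{ij}(Ũ) dμ` then
`∫ (O_q(τ₋ₓ Ũ) − m/6) dμ = 0` for every plane `q` and every corner `x`. [folklore] -/
theorem integral_planeSpecies_shift_sub_eq_zero (r : LatticeRep G) (β : ℝ) (S : ℕ) [NeZero S] (q : Plane)
    (x : Site 4) {m : ℝ}
    (hm : m = ∫ U, r.curvature.F (torusLift S U) ∂(wilsonMeasure r.ρ β : Measure (GaugeConfig 4 S G))) :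
    ∫ U, ((planeSpecies r q).F (configShift (-x) (torusLift S U)) - m / 6)
        ∂(wilsonMeasure r.ρ β : Measure (GaugeConfig 4 S G)) = 0 := by
  haveI : IsProbabilityMeasure (wilsonMeasure r.ρ β : Measure (GaugeConfig 4 S G)) :=
    isProbabilityMeasure_wilsonMeasure (d := 4) (L := S) r.ρ r.continuous β
  have hI : Integrable (fun U : GaugeConfig 4 S G => (planeSpecies r q).F (configShift (-x) (torusLift S U)))
      (wilsonMeasure r.ρ β) := by
    simpa only [sub_zero] using integrable_shift_lift r.ρ r.continuous β S (planeSpecies r q).measurable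
      (planeSpecies r q).bounded x 0
  rw [integral_sub hI (integrable_const _), integral_const, probReal_univ, one_smul, sub_eq_zero,
    integral_comp_configShift_torusLift (S := S) r.ρ β (planeSpecies r q).F (-x), planeSpecies_F, hm,
    integral_curvature_F_torusLift, integral_plaquetteObs_torusLift_eq r β S (ne_of_lt q.2)]
  ring

end Torus

/-! ## The stub -/

/-- **Registered stub `stub_planeMean` (line `Sketch`).**  For every scheme `S` whose curvature counterterm at step
`k` is the torus mean of the action density, `m_k = ∫ tr-density(Ũ) dμ_k`, every plane field has vanishing one-point
function: `∫ Φ^{q}_k(f) dμ_k = 0` — the six plaquette orientations have equal means under Wilson's hypercubically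
symmetric, translation-invariant torus state, so each equals `m_k / 6`. [folklore] -/
theorem stub_planeMean :
    ∀ (G : Type) [Group G] [TopologicalSpace G] [IsTopologicalGroup G] [CompactSpace G] [MeasurableSpace G]
      [BorelSpace G] (r : LatticeRep G) (S : SpeciesScheme (YMSpecies G)) (k : ℕ),
      S.m r.curvature k = ∫ U, r.curvature.F (torusLift (S.side k) U) ∂(wilsonMeasure r.ρ (S.β k) :
        Measure (GaugeConfig 4 (S.side k) G)) →
      ∀ (q : Plane) (f : 𝓢(EuclideanSpace ℝ (Fin 4), ℝ)), ∫ U, planeField r S k q f U ∂(wilsonAt r S k) = 0 := by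
  intro G _ _ _ _ _ _ r S k hm q f
  rw [integral_planeField_eq]
  have h0 : ∀ x : Site 4, ∫ U, ((planeSpecies r q).F (configShift (-x) (torusLift (S.side k) U)) -
      S.m r.curvature k / 6) ∂(wilsonAt r S k) = 0 := fun x =>
    integral_planeSpecies_shift_sub_eq_zero r (S.β k) (S.side k) q x hm
  simp only [h0, mul_zero, Finset.sum_const_zero]

end Summit.QuantumFields.YangMills.Theorems.ScalingWindowSplit.SelfNormalisedMomentBoundsR

end
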